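import Summits.CriticalPhenomena.PercolationContinuityZ3.Theorems.Transplant.PlanarSkeletonFrmEscape
import Summits.CriticalPhenomena.PercolationContinuityZ3.Theorems.Transplant.CayleyCylinderKit
import HarnessLib

/-!
# Φ2 at the interface level, XIII: the CYCLE KIT of a small-cylinder edge from ESCAPE DATA (any number of types)

builds on p205010 (kernel theorem, internal audit signed; external expert review pending) — nothing in this file uses p205010; nothing
here is a claim about any open node.
Lane `prim-bschramm`, seat `prim-bschramm-p4` gen 14 (PART C3 of `P4-GENERAL.md`, §36.7).  Helper file
(`--supports stmt-CriticalPhenomena-4575 --as helper`).  No probability.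

`exists_kit_esc`: the multi-type twin of file IV's `exists_kit` — columns = the two escapes supplied by `E : EscData` (inside their classes,
inside `Λ_{ℓ+2}`, ending outside `Λ_ℓ`), run = one step onto the ring `‖·‖_∞ = ℓ+2` + along the ring to the north-east corner (file XII) +
a fibre adjustment between the two corner vertices (uniform bound `N` from file III) + the reversed ring walk of the other end; meeting
conditions by `SubLoc.exists_cycleKit_of_walks`; zone radius `2R₁ + 16ℓ + 37 + N`.
[cite: AizenmanGrimmett1991, Thm 1 (essential enhancements)] [cite: BalisterBollobasRiordan2014, §"bond percolation" p. 13]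
-/

noncomputable section

namespace Summit.CriticalPhenomena.PercolationContinuityZ3.Theorems.Transplant

namespace PlanarSkeletonFrm

open SimpleGraph Walk Literature.Probability.LatticeModels SubLoc
open Literature.Barriers.CriticalPhenomena (graphBall graphBall_finite)
open scoped Classical

variable {V : Type} {G : SimpleGraph V} [G.LocallyFinite] (Φ : PlanarSkeletonFrm G)

/-- A vertex of `Λ_{ℓ+2}` relative to `t` lies in the big cylinder `C_{ℓ+3}(t)`. [folklore] -/
theorem mem_cyl_of_mem_box_add_two {t w : V} {ℓ : ℕ} (h : Φ.φ w - Φ.φ t ∈ box 2 (ℓ + 2)) : w ∈ Φ.cyl t (ℓ + 3) := by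
  have h2 := mem_box_two.1 h
  simp only [Pi.sub_apply] at h2
  exact Φ.mem_cyl_two.2 ⟨h2.1.trans (by push_cast; linarith), h2.2.trans (by push_cast; linarith)⟩

/-- **THE CYCLE KIT of a small-cylinder edge from escape data.** [cite: AizenmanGrimmett1991, Thm 1 (essential enhancements)]
[cite: BalisterBollobasRiordan2014, §"bond percolation" p. 13] -/
theorem exists_kit_esc {t : V} {ℓ : ℕ} (E : Φ.EscData t ℓ) {N : ℕ}
    (hN : ∀ w w' : V, Φ.φ w' = Φ.φ w → w' ∈ graphBall G w (2 * E.R₁ + 16 * ℓ + 37) →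
      ∃ W : G.Walk w w', W.length ≤ N ∧ ∀ z ∈ W.support, Φ.φ z - Φ.φ w ∈ box 2 1)
    (x y : Φ.cyl t (ℓ + 3)) (hxy : s(x, y) ∈ Φ.EH t ℓ) :
    ∃ K : CycleKit (G.induce (Φ.cyl t (ℓ + 3))) (Φ.Eenh t ℓ) x y,
      (∀ w ∈ K.A.support, E.cls w.1 = E.cls x.1) ∧ (∀ w ∈ K.B.support, E.cls w.1 = E.cls y.1) ∧
      K.Z ⊆ graphBall (G.induce (Φ.cyl t (ℓ + 3))) x (2 * E.R₁ + 16 * ℓ + 37 + N) := by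
  have hadj : (G.induce (Φ.cyl t (ℓ + 3))).Adj x y := hxy.1
  have hGadj : G.Adj x.1 y.1 := hadj
  have hxb : Φ.φ x.1 - Φ.φ t ∈ box 2 ℓ := hxy.2 x (Sym2.mem_mk_left _ _)
  have hyb : Φ.φ y.1 - Φ.φ t ∈ box 2 ℓ := hxy.2 y (Sym2.mem_mk_right _ _)
  -- the escapes
  obtain ⟨p, q, A₀, B₀, hAP, hBP, hAl, hBl, hAB₀, hAcls, hBcls, hpout, hqout⟩ := E.esc x.1 y.1 hGadj hxb hyb
  have hpin : Φ.φ p - Φ.φ t ∈ box 2 (ℓ + 2) := (hAcls p A₀.end_mem_support).2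
  have hqin : Φ.φ q - Φ.φ t ∈ box 2 (ℓ + 2) := (hBcls q B₀.end_mem_support).2
  -- onto the ring and to the corner, from both ends
  obtain ⟨rp, Wp₁, hp₁l, hrpin, hrpring, hp₁sup⟩ := Φ.exists_walk_to_ring t p ℓ hpin hpout
  obtain ⟨cp, Wp₂, hcp0, hcp1, hp₂l, hp₂sup⟩ := Φ.exists_ring_to_corner t rp ℓ hrpin hrpring
  obtain ⟨rq, Wq₁, hq₁l, hrqin, hrqring, hq₁sup⟩ := Φ.exists_walk_to_ring t q ℓ hqin hqout
  obtain ⟨cq, Wq₂, hcq0, hcq1, hq₂l, hq₂sup⟩ := Φ.exists_ring_to_corner t rq ℓ hrqin hrqring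
  -- the fibre adjustment between the two corner vertices
  have hφc : Φ.φ cq = Φ.φ cp := by
    ext i
    match i with
    | 0 => omega
    | 1 => omega
  have hball : cq ∈ graphBall G cp (2 * E.R₁ + 16 * ℓ + 37) := by
    refine ⟨(((Wp₁.append Wp₂).reverse.append A₀.reverse).append (Walk.cons hGadj B₀)).append (Wq₁.append Wq₂), ?_⟩
    simp only [Walk.length_append, Walk.length_reverse, Walk.length_cons]
    omega
  obtain ⟨WJ, hJl, hJsup⟩ := hN cp cq hφc hball
  -- the run in `G` and its membership
  set M₀G : G.Walk p q := ((Wp₁.append Wp₂).append WJ).append (Wq₁.append Wq₂).reverse with hM₀G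
  have ring_out : ∀ u : V, Φ.φ u - Φ.φ t ∈ box 2 (ℓ + 2) →
      (|Φ.φ u 0 - Φ.φ t 0| = (ℓ : ℤ) + 2 ∨ |Φ.φ u 1 - Φ.φ t 1| = (ℓ : ℤ) + 2) → Φ.φ u - Φ.φ t ∉ box 2 ℓ := by
    intro u _ hr hin
    have h2 := mem_box_two.1 hin
    simp only [Pi.sub_apply] at h2
    rcases hr with h | h
    · have := h2.1; rw [h] at this; omega
    · have := h2.2; rw [h] at this; omega
  have hMmem : ∀ z ∈ M₀G.support, z ∈ Φ.cyl t (ℓ + 3) ∧ Φ.φ z - Φ.φ t ∉ box 2 ℓ := by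
    intro z hz
    simp only [hM₀G, Walk.mem_support_append_iff, Walk.support_reverse, List.mem_reverse] at hz
    rcases hz with ((hz | hz) | hz) | (hz | hz)
    · exact ⟨Φ.mem_cyl_of_mem_box_add_two (hp₁sup z hz).1, (hp₁sup z hz).2⟩
    · exact ⟨Φ.mem_cyl_of_mem_box_add_two (hp₂sup z hz).1, ring_out z (hp₂sup z hz).1 (hp₂sup z hz).2⟩
    · have hz1 := mem_box_two.1 (hJsup z hz)
      simp only [Pi.sub_apply] at hz1
      obtain ⟨hz0, hz1⟩ := hz1
      rw [abs_le] at hz0 hz1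
      refine ⟨Φ.mem_cyl_two.2 ⟨abs_le.2 ⟨by push_cast; omega, by push_cast; omega⟩,
        abs_le.2 ⟨by push_cast; omega, by push_cast; omega⟩⟩, fun hin => ?_⟩
      obtain ⟨hin0, -⟩ := mem_box_two.1 hin
      simp only [Pi.sub_apply] at hin0
      rw [abs_le] at hin0
      omega
    · exact ⟨Φ.mem_cyl_of_mem_box_add_two (hq₁sup z hz).1, (hq₁sup z hz).2⟩
    · exact ⟨Φ.mem_cyl_of_mem_box_add_two (hq₂sup z hz).1, ring_out z (hq₂sup z hz).1 (hq₂sup z hz).2⟩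
  have hAmem : ∀ z ∈ A₀.support, z ∈ Φ.cyl t (ℓ + 3) := fun z hz => Φ.mem_cyl_of_mem_box_add_two (hAcls z hz).2
  have hBmem : ∀ z ∈ B₀.support, z ∈ Φ.cyl t (ℓ + 3) := fun z hz => Φ.mem_cyl_of_mem_box_add_two (hBcls z hz).2
  -- the three walks in `H`
  set A : (G.induce (Φ.cyl t (ℓ + 3))).Walk x ⟨p, hAmem _ A₀.end_mem_support⟩ := A₀.induce (Φ.cyl t (ℓ + 3)) hAmem with hAdef
  set Bi : (G.induce (Φ.cyl t (ℓ + 3))).Walk y ⟨q, hBmem _ B₀.end_mem_support⟩ := B₀.induce (Φ.cyl t (ℓ + 3)) hBmem with hBidef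
  set M₀ : (G.induce (Φ.cyl t (ℓ + 3))).Walk ⟨p, hAmem _ A₀.end_mem_support⟩ ⟨q, hBmem _ B₀.end_mem_support⟩ :=
    M₀G.induce (Φ.cyl t (ℓ + 3)) (fun z hz => (hMmem z hz).1) with hM₀def
  have hA : A.IsPath := (CayCyl.isPath_induce_iff _ _).2 hAP
  have hB : Bi.reverse.IsPath := ((CayCyl.isPath_induce_iff _ _).2 hBP).reverse
  have hmemA : ∀ w, w ∈ A.support → w.1 ∈ A₀.support := fun w hw => (CayCyl.mem_support_induce_iff _ _ w).1 hw
  have hmemB : ∀ w, w ∈ Bi.reverse.support → w.1 ∈ B₀.support := fun w hw =>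
    (CayCyl.mem_support_induce_iff _ _ w).1 (by rwa [Walk.support_reverse, List.mem_reverse] at hw)
  have hmemM : ∀ w, w ∈ M₀.support → w.1 ∈ M₀G.support := fun w hw => (CayCyl.mem_support_induce_iff _ _ w).1 hw
  have hAB : ∀ w, w ∈ A.support → w ∈ Bi.reverse.support → False :=
    fun w hwA hwB => hAB₀ w.1 (hmemA w hwA) (hmemB w hwB)
  set P : Φ.cyl t (ℓ + 3) → Prop := fun z => Φ.φ z.1 - Φ.φ t ∉ box 2 ℓ with hP
  have hM₀P : ∀ w ∈ M₀.support, P w := fun w hw => (hMmem w.1 (hmemM w hw)).2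
  have hE : ∀ ⦃u v : Φ.cyl t (ℓ + 3)⦄, (G.induce (Φ.cyl t (ℓ + 3))).Adj u v → P u → P v → s(u, v) ∈ Φ.Eenh t ℓ :=
    fun u v huv hu _ => ⟨huv, fun hall => hu (hall u (Sym2.mem_mk_left _ _))⟩
  obtain ⟨K, hKA, hKB, hKM⟩ := SubLoc.exists_cycleKit_of_walks A Bi.reverse M₀ hA hB hAB P hM₀P
    (fun h => h hxb) (fun h => h hyb) hE hadj.symm
  refine ⟨K, fun w hw => (hAcls w.1 (hmemA w (hKA w hw))).1, fun w hw => (hBcls w.1 (hmemB w (hKB w hw))).1, ?_⟩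
  -- the zone radius
  have hAl' : A.length ≤ E.R₁ := by rw [hAdef, CayCyl.length_induce]; exact hAl
  have hBl' : Bi.length ≤ E.R₁ := by rw [hBidef, CayCyl.length_induce]; exact hBl
  have hMl : M₀.length ≤ 16 * ℓ + 34 + N := by
    rw [hM₀def, CayCyl.length_induce, hM₀G]
    simp only [Walk.length_append, Walk.length_reverse]
    omega
  intro w hw
  rcases K.Z_subset_of_supports hKA hKB hKM hw with hw | hw | hw
  · exact ⟨A.takeUntil w hw, (A.length_takeUntil_le_length hw).trans (by omega)⟩
  · have hw' : w ∈ (A.append M₀).support := by rw [Walk.mem_support_append_iff]; exact Or.inr hw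
    refine ⟨(A.append M₀).takeUntil w hw', ((A.append M₀).length_takeUntil_le_length hw').trans ?_⟩
    rw [Walk.length_append]; omega
  · have hw' : w ∈ (Walk.cons hadj Bi).support := by
      rw [Walk.support_cons, List.mem_cons]
      rw [Walk.support_reverse, List.mem_reverse] at hw
      exact Or.inr hw
    refine ⟨(Walk.cons hadj Bi).takeUntil w hw', ((Walk.cons hadj Bi).length_takeUntil_le_length hw').trans ?_⟩
    rw [Walk.length_cons]; omega

end PlanarSkeletonFrm

end Summit.CriticalPhenomena.PercolationContinuityZ3.Theorems.Transplant

end
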